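import Summits.NavierStokesRegularity.NavierStokesRegularity.Theses.HubbleDynamo
import HarnessLib.Audit

/-!
# Birth skeleton (BC3) of the crux `HubbleDynamo.FarFieldSlaving`

(crux item `stmt-NavierStokesRegularity-1935`, rank 3, route `route-NavierStokesRegularity-HubbleDynamo`;
tree path `Cruxes/FarFieldSlaving/Lines/birth.lean`; registrar
`planner-skel-stmt-NavierStokesRegularity-1935-0`, 2026-08-17. The route predates the Lean birth
certificate; this file supplies BC3 retroactively. No `Disproof.lean` exists for this crux yet.)

THE CRUX. `FarFieldSlaving`: for a finite-energy classical solution on `[0, T)` from a rapidly decaying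
datum with the Type-I RATE IN TIME `‖u(t)‖_∞ ≤ C (T − t)^{-1/2}` (`IsTypeIBlowup u T`), EVERY point `x₀`
is a space-time Type-I centre: `‖u t x‖ ≤ C' / (‖x − x₀‖ + √(T − t))` on `B_δ(x₀) × (T − δ², T)`.

THE CUT (Type I in time ⇒ Type I in space, read through the VORTICITY as the route's dictionary asks:
"frozen-flux comparison for |y|²|Ω| along V-characteristics + a pressure-tail estimate"). Inside the
parabolic core `‖x − x₀‖ ≤ √(T − t)` the rate is the hypothesis; the content is the ANNULUS
`√(T − t) ≤ ‖x − x₀‖ ≤ δ`, and there it splits into four genuine lemmas, two open and two known: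

* `stub_isolatedSingularPoints` [L, OPEN] — under the Type-I rate every `x₀` has a punctured
  neighbourhood of points that are regular up to time `T` (u bounded on a small parabolic cylinder below
  `(x, T)`), i.e. the time-`T` singular set has no accumulation point. Necessary for the crux (singular
  points accumulating at `x₀` are incompatible with `‖u‖ ≤ C'/‖x − x₀‖` near them). Known only under the
  STRONGER `L^∞_t L^{3,∞}_x` Type-I condition (Choe–Wolf–Yang 2019; Barker 2024, arXiv:2111.14776);
  open under the sup-norm rate. Why it might fail: a Type-I (in time) blow-up whose singular set at time
  `T` is a Cantor set / a curve is not excluded by any theorem.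
* `stub_vorticityTypeIRate` [M, KNOWN] — the Type-I rate passes to the vorticity:
  `‖curl (u t) x‖ ≤ A / (T − t)` for all `x` and `t < T` close to `T` (KNSS 2009 Prop. 4.1 / (4.6) with
  `k = 1` on the window `[t − (T − t)/max(1, C²), t]`, where `‖u‖_∞ ≤ C (T − t)^{-1/2}`; in-tree machinery
  `IsKNSSDriftMild.exists_gradient_bound`, `KNSS2009_prop41_mild`; classical + Leray–Hopf ⇒ mild).
* `stub_vorticityDilution` [XL, OPEN — the heart, the route's Hubble-dilution mechanism] — at a point with
  a punctured-regular neighbourhood, the vorticity is Type I IN SPACE on the annulus: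
  `‖curl (u t) x‖ ≤ A / ‖x − x₀‖²` for `√(T − t) ≤ ‖x − x₀‖ < δ`. In similarity variables
  `y = (x − x₀)/√(2a(T − t))` this is `|Ω(y, s)| ≲ |y|^{-2}` outside the core: the field is frozen into the
  outflow `V = U + a y` and diluted (`|Ω| ↓ e^{-2as}` while `|y| ↑ e^{as}`). Necessary for the crux modulo
  scale-invariant local regularity (the crux bound on `Q_{r/2}(x, t)`, `r = ‖x − x₀‖`, gives
  `|∇u| ≲ r^{-2}`). Why it might fail: the non-local pressure lets the core drive the annulus; known only
  axisymmetric (KNSS 2009 Thm 6.2, Seregin–Šverák 2009) and backward-DSS (Chae–Wolf 2017 Thm 1.1).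
* `stub_velocityFromVorticity` [M/L, KNOWN kinematics] — a vorticity bound `A / (‖x − x₀‖² + (T − t))`
  on a parabolic cylinder below `(x₀, T)` gives the velocity bound `C / (‖x − x₀‖ + √(T − t))` on a
  smaller one: `u(t) = curl (N ∗ χω(t)) + h(t)` on `B_{δ/2}(x₀)` with `h(t)` harmonic, the local
  Biot–Savart term is `≲ A/(‖x − x₀‖ + √(T − t))` by direct integration (no logarithm), and
  `‖h(t)‖_{L^∞(B_{δ/4})} ≲ δ^{-3/2}(‖u(t)‖_{L²} + ‖curl(N ∗ χω)‖_{L²(B_{δ/2})})` is bounded uniformly in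
  `t` by the Leray–Hopf energy inequality (`IsLerayHopfOn.weakGrad_energy`, force `0`).

`FarFieldSlaving_of : Theses.HubbleDynamo.FarFieldSlaving` (the ONLY theorem here concluding the crux, BY
NAME, no hypotheses) is `farFieldSlaving_of_hyps` applied to the four stubs, and
`farFieldSlaving_of_hyps` (the stub STATEMENTS as hypotheses, conclusion = the crux unfolded; ≈ 60 lines,
no placeholder) is the real composition: isolation feeds dilution (annulus, `δ₁`, `A₁`), the vorticity
rate gives the core (`t₀`, `A₀`); with `δ := min δ₁ √(T − t₀)` and `A := 2(|A₀| + |A₁|)` the case split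
`√(T − t) ≤ ‖x − x₀‖` / `<` yields the full-cylinder vorticity bound `A / (‖x − x₀‖² + (T − t))`, and the
kinematic stub turns it into the crux's conclusion at `x₀`. Its closed twin (conclusion the crux by name)
is the registrar's evidence file `bc/FarFieldSlaving_birth_closed.lean`.

BC3 PROBES (folder `bc/probe_*.lean`): for each stub `S`, `S → FarFieldSlaving` and
`S → NavierStokesRegularity` (and `S → ¬NavierStokesRegularity`) by `first | exact? | simpa | aesop` all
FAIL — no stub is cheaply the crux or the summit (results quoted in `Lines/birth.md` and the registrar's
NOTES.md). Junk audit: every existential radius/time in the stubs can be taken with `r² ≤ T`, so no stub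
is forced to speak about the unconstrained slices `u t`, `t < 0`; hypotheses that mention such times only
weaken the stub.
-/

noncomputable section

open Set Filter Topology

namespace Summit.NavierStokesRegularity.NavierStokesRegularity.Cruxes.FarFieldSlaving.Birth

set_option linter.unusedVariables false
set_option linter.dupNamespace false

/-- **stub A — `stub_isolatedSingularPoints` (L, OPEN).** Under the Type-I rate in time, every point
`x₀` has a punctured neighbourhood of points regular up to time `T`: for `x ≠ x₀` close to `x₀` the
velocity is bounded on some parabolic cylinder `B_r(x) × (T − r², T)`. Known under the stronger
`L^∞_t L^{3,∞}_x` Type-I condition (Choe–Wolf–Yang 2019; Barker 2024, arXiv:2111.14776: finitely many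
singular points); open under the sup-norm rate alone. -/
theorem stub_isolatedSingularPoints :
    ∀ (ν T : ℝ), 0 < ν → 0 < T →
      ∀ (u : ℝ → EuclideanSpace ℝ (Fin 3) → EuclideanSpace ℝ (Fin 3))
        (p : ℝ → EuclideanSpace ℝ (Fin 3) → ℝ),
        Literature.Analysis.FluidPDE.IsClassicalNSSolutionOn (Set.Ico 0 T) ν 0 u p →
        Literature.Analysis.FluidPDE.IsLerayHopfOn T ν 0 (u 0) u →
        Literature.Analysis.FluidPDE.HasRapidSpatialDecay (u 0) →
        Literature.Analysis.FluidPDE.IsTypeIBlowup u T →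
        ∀ x₀ : EuclideanSpace ℝ (Fin 3), ∃ ρ : ℝ, 0 < ρ ∧
          ∀ x ∈ Metric.ball x₀ ρ, x ≠ x₀ →
            ∃ r : ℝ, 0 < r ∧ ∃ M : ℝ, ∀ t ∈ Set.Ioo (T - r ^ 2) T, ∀ y ∈ Metric.ball x r,
              ‖u t y‖ ≤ M := by
  sorry

/-- **stub B0 — `stub_vorticityTypeIRate` (M, KNOWN).** The Type-I rate in time passes to the
vorticity: `‖curl (u t) x‖ ≤ A / (T − t)` for every `x` and all `t < T` close to `T` (KNSS 2009,
Prop. 4.1 / (4.6), `k = 1`, applied on the window `[t − (T − t)/max(1, C²), t]`; in-tree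
`IsKNSSDriftMild.exists_gradient_bound`). -/
theorem stub_vorticityTypeIRate :
    ∀ (ν T : ℝ), 0 < ν → 0 < T →
      ∀ (u : ℝ → EuclideanSpace ℝ (Fin 3) → EuclideanSpace ℝ (Fin 3))
        (p : ℝ → EuclideanSpace ℝ (Fin 3) → ℝ),
        Literature.Analysis.FluidPDE.IsClassicalNSSolutionOn (Set.Ico 0 T) ν 0 u p →
        Literature.Analysis.FluidPDE.IsLerayHopfOn T ν 0 (u 0) u →
        Literature.Analysis.FluidPDE.HasRapidSpatialDecay (u 0) →
        Literature.Analysis.FluidPDE.IsTypeIBlowup u T →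
        ∃ t₀ : ℝ, t₀ < T ∧ ∃ A : ℝ, ∀ t ∈ Set.Ioo t₀ T, ∀ x : EuclideanSpace ℝ (Fin 3),
          ‖Literature.Analysis.FluidPDE.curl (u t) x‖ ≤ A / (T - t) := by
  sorry

/-- **stub B1 — `stub_vorticityDilution` (XL, OPEN; the Hubble-dilution heart).** At a point `x₀`
with a punctured neighbourhood of points regular up to time `T`, the Type-I rate in time forces Type I
IN SPACE for the vorticity on the parabolic annulus: `‖curl (u t) x‖ ≤ A / ‖x − x₀‖²` whenever
`√(T − t) ≤ ‖x − x₀‖ < δ`, `T − δ² < t < T`. Known axisymmetric (KNSS 2009 Thm 6.2 / Seregin–Šverák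
2009) and for backward DSS (Chae–Wolf 2017 Thm 1.1); open in general. -/
theorem stub_vorticityDilution :
    ∀ (ν T : ℝ), 0 < ν → 0 < T →
      ∀ (u : ℝ → EuclideanSpace ℝ (Fin 3) → EuclideanSpace ℝ (Fin 3))
        (p : ℝ → EuclideanSpace ℝ (Fin 3) → ℝ),
        Literature.Analysis.FluidPDE.IsClassicalNSSolutionOn (Set.Ico 0 T) ν 0 u p →
        Literature.Analysis.FluidPDE.IsLerayHopfOn T ν 0 (u 0) u →
        Literature.Analysis.FluidPDE.HasRapidSpatialDecay (u 0) →
        Literature.Analysis.FluidPDE.IsTypeIBlowup u T →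
        ∀ x₀ : EuclideanSpace ℝ (Fin 3),
          (∃ ρ : ℝ, 0 < ρ ∧ ∀ x ∈ Metric.ball x₀ ρ, x ≠ x₀ →
              ∃ r : ℝ, 0 < r ∧ ∃ M : ℝ, ∀ t ∈ Set.Ioo (T - r ^ 2) T, ∀ y ∈ Metric.ball x r,
                ‖u t y‖ ≤ M) →
          ∃ δ : ℝ, 0 < δ ∧ ∃ A : ℝ, ∀ t ∈ Set.Ioo (T - δ ^ 2) T, ∀ x ∈ Metric.ball x₀ δ,
            Real.sqrt (T - t) ≤ ‖x - x₀‖ →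
              ‖Literature.Analysis.FluidPDE.curl (u t) x‖ ≤ A / ‖x - x₀‖ ^ 2 := by
  sorry

/-- **stub B2 — `stub_velocityFromVorticity` (M/L, KNOWN kinematics).** For a classical Leray–Hopf
solution on `[0, T)`, a space-time Type-I bound for the VORTICITY on a parabolic cylinder below
`(x₀, T)`, `‖curl (u t) x‖ ≤ A / (‖x − x₀‖² + (T − t))`, yields the space-time Type-I bound for the
VELOCITY on a smaller cylinder, `‖u t x‖ ≤ C / (‖x − x₀‖ + √(T − t))`: local Biot–Savart representation
`u(t) = curl (N ∗ χ ω(t)) + h(t)` with `h(t)` harmonic on `B_{δ/2}(x₀)`, direct integration of the kernel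
against the bound (no logarithm), and the mean-value estimate for `h(t)` with the Leray–Hopf energy
inequality (`IsLerayHopfOn.weakGrad_energy`, force `0`) for uniformity in `t`. -/
theorem stub_velocityFromVorticity :
    ∀ (ν T : ℝ), 0 < ν → 0 < T →
      ∀ (u : ℝ → EuclideanSpace ℝ (Fin 3) → EuclideanSpace ℝ (Fin 3))
        (p : ℝ → EuclideanSpace ℝ (Fin 3) → ℝ),
        Literature.Analysis.FluidPDE.IsClassicalNSSolutionOn (Set.Ico 0 T) ν 0 u p →
        Literature.Analysis.FluidPDE.IsLerayHopfOn T ν 0 (u 0) u →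
        ∀ x₀ : EuclideanSpace ℝ (Fin 3),
          (∃ δ : ℝ, 0 < δ ∧ ∃ A : ℝ, ∀ t ∈ Set.Ioo (T - δ ^ 2) T, ∀ x ∈ Metric.ball x₀ δ,
              ‖Literature.Analysis.FluidPDE.curl (u t) x‖ ≤ A / (‖x - x₀‖ ^ 2 + (T - t))) →
          ∃ δ : ℝ, 0 < δ ∧ ∃ C : ℝ, ∀ t ∈ Set.Ioo (T - δ ^ 2) T, ∀ x ∈ Metric.ball x₀ δ,
            ‖u t x‖ ≤ C / (‖x - x₀‖ + Real.sqrt (T - t)) := by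
  sorry

/-- **The assembly with the stub STATEMENTS as hypotheses** (conclusion = the crux, unfolded; no
placeholder). Isolation feeds dilution on the annulus, the vorticity rate covers the core; with
`δ := min δ₁ √(T − t₀)` and `A := 2 (|A₀| + |A₁|)` the case split `√(T − t) ≤ ‖x − x₀‖` / `<` gives the
full-cylinder vorticity bound `A / (‖x − x₀‖² + (T − t))`, which the kinematic stub converts into the
crux's conclusion at `x₀`. -/
theorem farFieldSlaving_of_hyps
    (hA : ∀ (ν T : ℝ), 0 < ν → 0 < T →
      ∀ (u : ℝ → EuclideanSpace ℝ (Fin 3) → EuclideanSpace ℝ (Fin 3))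
        (p : ℝ → EuclideanSpace ℝ (Fin 3) → ℝ),
        Literature.Analysis.FluidPDE.IsClassicalNSSolutionOn (Set.Ico 0 T) ν 0 u p →
        Literature.Analysis.FluidPDE.IsLerayHopfOn T ν 0 (u 0) u →
        Literature.Analysis.FluidPDE.HasRapidSpatialDecay (u 0) →
        Literature.Analysis.FluidPDE.IsTypeIBlowup u T →
        ∀ x₀ : EuclideanSpace ℝ (Fin 3), ∃ ρ : ℝ, 0 < ρ ∧
          ∀ x ∈ Metric.ball x₀ ρ, x ≠ x₀ →
            ∃ r : ℝ, 0 < r ∧ ∃ M : ℝ, ∀ t ∈ Set.Ioo (T - r ^ 2) T, ∀ y ∈ Metric.ball x r,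
              ‖u t y‖ ≤ M)
    (hB0 : ∀ (ν T : ℝ), 0 < ν → 0 < T →
      ∀ (u : ℝ → EuclideanSpace ℝ (Fin 3) → EuclideanSpace ℝ (Fin 3))
        (p : ℝ → EuclideanSpace ℝ (Fin 3) → ℝ),
        Literature.Analysis.FluidPDE.IsClassicalNSSolutionOn (Set.Ico 0 T) ν 0 u p →
        Literature.Analysis.FluidPDE.IsLerayHopfOn T ν 0 (u 0) u →
        Literature.Analysis.FluidPDE.HasRapidSpatialDecay (u 0) →
        Literature.Analysis.FluidPDE.IsTypeIBlowup u T →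
        ∃ t₀ : ℝ, t₀ < T ∧ ∃ A : ℝ, ∀ t ∈ Set.Ioo t₀ T, ∀ x : EuclideanSpace ℝ (Fin 3),
          ‖Literature.Analysis.FluidPDE.curl (u t) x‖ ≤ A / (T - t))
    (hB1 : ∀ (ν T : ℝ), 0 < ν → 0 < T →
      ∀ (u : ℝ → EuclideanSpace ℝ (Fin 3) → EuclideanSpace ℝ (Fin 3))
        (p : ℝ → EuclideanSpace ℝ (Fin 3) → ℝ),
        Literature.Analysis.FluidPDE.IsClassicalNSSolutionOn (Set.Ico 0 T) ν 0 u p →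
        Literature.Analysis.FluidPDE.IsLerayHopfOn T ν 0 (u 0) u →
        Literature.Analysis.FluidPDE.HasRapidSpatialDecay (u 0) →
        Literature.Analysis.FluidPDE.IsTypeIBlowup u T →
        ∀ x₀ : EuclideanSpace ℝ (Fin 3),
          (∃ ρ : ℝ, 0 < ρ ∧ ∀ x ∈ Metric.ball x₀ ρ, x ≠ x₀ →
              ∃ r : ℝ, 0 < r ∧ ∃ M : ℝ, ∀ t ∈ Set.Ioo (T - r ^ 2) T, ∀ y ∈ Metric.ball x r,
                ‖u t y‖ ≤ M) →
          ∃ δ : ℝ, 0 < δ ∧ ∃ A : ℝ, ∀ t ∈ Set.Ioo (T - δ ^ 2) T, ∀ x ∈ Metric.ball x₀ δ,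
            Real.sqrt (T - t) ≤ ‖x - x₀‖ →
              ‖Literature.Analysis.FluidPDE.curl (u t) x‖ ≤ A / ‖x - x₀‖ ^ 2)
    (hB2 : ∀ (ν T : ℝ), 0 < ν → 0 < T →
      ∀ (u : ℝ → EuclideanSpace ℝ (Fin 3) → EuclideanSpace ℝ (Fin 3))
        (p : ℝ → EuclideanSpace ℝ (Fin 3) → ℝ),
        Literature.Analysis.FluidPDE.IsClassicalNSSolutionOn (Set.Ico 0 T) ν 0 u p →
        Literature.Analysis.FluidPDE.IsLerayHopfOn T ν 0 (u 0) u →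
        ∀ x₀ : EuclideanSpace ℝ (Fin 3),
          (∃ δ : ℝ, 0 < δ ∧ ∃ A : ℝ, ∀ t ∈ Set.Ioo (T - δ ^ 2) T, ∀ x ∈ Metric.ball x₀ δ,
              ‖Literature.Analysis.FluidPDE.curl (u t) x‖ ≤ A / (‖x - x₀‖ ^ 2 + (T - t))) →
          ∃ δ : ℝ, 0 < δ ∧ ∃ C : ℝ, ∀ t ∈ Set.Ioo (T - δ ^ 2) T, ∀ x ∈ Metric.ball x₀ δ,
            ‖u t x‖ ≤ C / (‖x - x₀‖ + Real.sqrt (T - t))) :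
    ∀ (ν T : ℝ), 0 < ν → 0 < T →
      ∀ (u : ℝ → EuclideanSpace ℝ (Fin 3) → EuclideanSpace ℝ (Fin 3))
        (p : ℝ → EuclideanSpace ℝ (Fin 3) → ℝ),
        Literature.Analysis.FluidPDE.IsClassicalNSSolutionOn (Set.Ico 0 T) ν 0 u p →
        Literature.Analysis.FluidPDE.IsLerayHopfOn T ν 0 (u 0) u →
        Literature.Analysis.FluidPDE.HasRapidSpatialDecay (u 0) →
        Literature.Analysis.FluidPDE.IsTypeIBlowup u T →
        ∀ x₀ : EuclideanSpace ℝ (Fin 3), ∃ δ : ℝ, 0 < δ ∧ ∃ C : ℝ,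
          ∀ t ∈ Set.Ioo (T - δ ^ 2) T, ∀ x ∈ Metric.ball x₀ δ,
            ‖u t x‖ ≤ C / (‖x - x₀‖ + Real.sqrt (T - t)) := by
  intro ν T hν hT u p hcl hLH hdec hTI x₀
  -- the annular dilution bound at `x₀` (isolation feeds it) and the core vorticity rate
  obtain ⟨δ₁, hδ₁, A₁, hann⟩ :=
    hB1 ν T hν hT u p hcl hLH hdec hTI x₀ (hA ν T hν hT u p hcl hLH hdec hTI x₀)
  obtain ⟨t₀, ht₀, A₀, hcore⟩ := hB0 ν T hν hT u p hcl hLH hdec hTI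
  have hTt₀ : 0 < T - t₀ := sub_pos.2 ht₀
  have hδpos : 0 < min δ₁ (Real.sqrt (T - t₀)) := lt_min hδ₁ (Real.sqrt_pos.2 hTt₀)
  -- feed the kinematic stub with the full-cylinder vorticity bound
  refine hB2 ν T hν hT u p hcl hLH x₀ ⟨min δ₁ (Real.sqrt (T - t₀)), hδpos, 2 * (|A₀| + |A₁|), ?_⟩
  intro t ht x hx
  set δ : ℝ := min δ₁ (Real.sqrt (T - t₀)) with hδ_def
  have hδ₁' : δ ≤ δ₁ := min_le_left _ _
  have hδt₀ : δ ≤ Real.sqrt (T - t₀) := min_le_right _ _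
  have htT : t < T := ht.2
  have hTt : 0 < T - t := sub_pos.2 htT
  -- `δ² ≤ T - t₀`, hence `t₀ < t`
  have hδsq : δ ^ 2 ≤ T - t₀ := by
    have h1 : δ * δ ≤ Real.sqrt (T - t₀) * Real.sqrt (T - t₀) :=
      mul_le_mul hδt₀ hδt₀ hδpos.le (Real.sqrt_nonneg _)
    rw [Real.mul_self_sqrt hTt₀.le] at h1
    simpa [sq] using h1
  have ht₀t : t₀ < t := by linarith [ht.1]
  -- `δ² ≤ δ₁²`, hence `t ∈ (T - δ₁², T)` and `x ∈ B_{δ₁}(x₀)`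
  have hδsq₁ : δ ^ 2 ≤ δ₁ ^ 2 := by
    have h1 : δ * δ ≤ δ₁ * δ₁ := mul_le_mul hδ₁' hδ₁' hδpos.le hδ₁.le
    simpa [sq] using h1
  have ht₁ : t ∈ Set.Ioo (T - δ₁ ^ 2) T := ⟨by linarith [ht.1], htT⟩
  have hx₁ : x ∈ Metric.ball x₀ δ₁ := Metric.ball_subset_ball hδ₁' hx
  -- the constant
  set K : ℝ := |A₀| + |A₁| with hK_def
  have hK0 : 0 ≤ K := add_nonneg (abs_nonneg _) (abs_nonneg _)
  have hA₀K : A₀ ≤ K := (le_abs_self A₀).trans (le_add_of_nonneg_right (abs_nonneg _))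
  have hA₁K : A₁ ≤ K := (le_abs_self A₁).trans (le_add_of_nonneg_left (abs_nonneg _))
  set r : ℝ := ‖x - x₀‖ with hr_def
  have hr0 : 0 ≤ r := norm_nonneg _
  have hden : 0 < r ^ 2 + (T - t) := by positivity
  by_cases hcase : Real.sqrt (T - t) ≤ r
  · -- annulus: the dilution bound
    have hrpos : 0 < r := lt_of_lt_of_le (Real.sqrt_pos.2 hTt) hcase
    have hr2 : 0 < r ^ 2 := by positivity
    have hTt_le : T - t ≤ r ^ 2 := by
      have h1 : Real.sqrt (T - t) * Real.sqrt (T - t) ≤ r * r :=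
        mul_le_mul hcase hcase (Real.sqrt_nonneg _) hr0
      rw [Real.mul_self_sqrt hTt.le] at h1
      simpa [sq] using h1
    calc ‖Literature.Analysis.FluidPDE.curl (u t) x‖ ≤ A₁ / r ^ 2 := hann t ht₁ x hx₁ hcase
      _ ≤ K / r ^ 2 := div_le_div_of_nonneg_right hA₁K hr2.le
      _ ≤ 2 * K / (r ^ 2 + (T - t)) := by
          rw [div_le_div_iff₀ hr2 hden]
          nlinarith
  · -- core: the Type-I rate of the vorticity
    have hcase : r < Real.sqrt (T - t) := lt_of_not_ge hcase
    have hr2lt : r ^ 2 < T - t := by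
      have h1 : r * r < Real.sqrt (T - t) * Real.sqrt (T - t) :=
        mul_lt_mul'' hcase hcase hr0 hr0
      rw [Real.mul_self_sqrt hTt.le] at h1
      simpa [sq] using h1
    calc ‖Literature.Analysis.FluidPDE.curl (u t) x‖ ≤ A₀ / (T - t) := hcore t ⟨ht₀t, htT⟩ x
      _ ≤ K / (T - t) := div_le_div_of_nonneg_right hA₀K hTt.le
      _ ≤ 2 * K / (r ^ 2 + (T - t)) := by
          rw [div_le_div_iff₀ hTt hden]
          nlinarith

/-- **Birth composition (the skeleton theorem).** The crux BY NAME from the four registered stubs,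
used by name; the composition is `farFieldSlaving_of_hyps` (real proof, no placeholder outside the
stubs). -/
theorem FarFieldSlaving_of : Theses.HubbleDynamo.FarFieldSlaving :=
  farFieldSlaving_of_hyps stub_isolatedSingularPoints stub_vorticityTypeIRate stub_vorticityDilution
    stub_velocityFromVorticity

end Summit.NavierStokesRegularity.NavierStokesRegularity.Cruxes.FarFieldSlaving.Birth
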